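import Summits.AtomisticToContinuum.FouriersLaw.Theses.BondHeatUncertainty
import Literature.MathematicalPhysics.KineticTheory.LangevinChainKernel
import Literature.MathematicalPhysics.KineticTheory.LangevinChainGibbs
import Literature.MathematicalPhysics.KineticTheory.LangevinChainNESSProofs
import Literature.MathematicalPhysics.KineticTheory.LangevinChainNESSFromH2
import Literature.MathematicalPhysics.KineticTheory.LangevinChainKernelDensity
import Literature.MathematicalPhysics.KineticTheory.LangevinChainTheorem51

/-!
# What weak-NESS uniqueness gives for free (helper for crux `LinearResponseFTUR`, stmt-AtomisticToContinuum-9122)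

Support file for line `lebesgue-flip-duality` of crux (★) `BondHeatUncertainty.LinearResponseFTUR`
(and usable verbatim by every line of the crux). Every stub of the line that mentions the steady-state
family `μ N T_L T_R` works under the crux's hypothesis (U) of weak-NESS uniqueness; under (U) the member
`μ N T_L T_R` (`N ≥ 2`, `T_L, T_R > 0`) IS the Krylov–Bogoliubov invariant measure of the constructed
transition semigroup `pinnedChainSemigroup` (`pinnedChainSemigroup_exists_isInvariant_of_pos`, PROVED in
`LangevinChainTheorem51.lean`), because that measure is a weak steady state
(`pinnedChain_isSteadyState_of_isInvariant`). Hence, from the tree and with no further input: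

* `ness_facts` (registered sub-goal on the item) — `μ N T_L T_R` is a probability measure, INVARIANT
  under the constructed kernels `OscillatorChain.transitionKernel N T_L T_R u` for every `u ≥ 0`,
  integrates `e^{ϑH}` for EVERY `0 < ϑ < 1/max(T_L,T_R)`, and is absolutely continuous w.r.t. Lebesgue
  measure (`pinnedChain_transitionKernel_one_absolutelyContinuous` +
  `IsInvariant.absolutelyContinuous_of_kernel`);
* `ness_eq_gibbsMeasure` — at equal temperatures the member is the Gibbs measure:
  `μ N T T = gibbsMeasure N T` (`pinnedChain_isSteadyState_gibbsMeasure` + (U)), for every `N`;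
* `gibbsMeasure_bind_transitionKernel` — hence, under (U), the Gibbs measure is invariant under the
  constructed equal-temperature kernels (`N ≥ 2`).

Nothing here closes an item.
-/

noncomputable section

namespace Summit.AtomisticToContinuum.FouriersLaw.Theorems.BondHeatUncertainty

open MeasureTheory ProbabilityTheory Filter Topology Set
open scoped NNReal ENNReal
open Literature.MathematicalPhysics.KineticTheory.HeatConduction Literature.Probability.Process

/-- **NESS facts from the tree, under (U).** For `N ≥ 2` and `T_L, T_R > 0` the member `μ N T_L T_R` of a
steady-state family of the pinned chain (all parameters positive) is: a probability measure, INVARIANT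
under the constructed transition kernels (`transitionKernel`), integrates `e^{ϑH}` for every
`0 < ϑ < 1/max(T_L, T_R)`, and is absolutely continuous w.r.t. Lebesgue measure — because the
Krylov–Bogoliubov invariant measure of `pinnedChainSemigroup` (`pinnedChainSemigroup_exists_isInvariant_of_pos`)
is a weak steady state (`pinnedChain_isSteadyState_of_isInvariant`) and (U) identifies it with
`μ N T_L T_R`; absolute continuity by `pinnedChain_transitionKernel_one_absolutelyContinuous` +
`IsInvariant.absolutelyContinuous_of_kernel`. Registered sub-goal of crux stmt-AtomisticToContinuum-9122. -/
theorem ness_facts :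
    ∀ ω₂ lam β γ : ℝ, 0 < ω₂ → 0 < lam → 0 < β → 0 < γ →
    (∀ (N : ℕ) (T_L T_R : ℝ), 0 < T_L → 0 < T_R → ∀ μ ν : Measure (PhaseSpace N),
      (pinnedChain ω₂ lam β γ).IsSteadyState N T_L T_R μ →
      (pinnedChain ω₂ lam β γ).IsSteadyState N T_L T_R ν → μ = ν) →
    ∀ μ : (N : ℕ) → ℝ → ℝ → Measure (PhaseSpace N),
      (∀ (N : ℕ) (T_L T_R : ℝ), 0 < T_L → 0 < T_R →
        (pinnedChain ω₂ lam β γ).IsSteadyState N T_L T_R (μ N T_L T_R)) →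
    ∀ (N : ℕ), 2 ≤ N → ∀ (T_L T_R : ℝ), 0 < T_L → 0 < T_R →
      IsProbabilityMeasure (μ N T_L T_R) ∧
      (∀ u : ℝ≥0, (μ N T_L T_R).bind ((pinnedChain ω₂ lam β γ).transitionKernel N T_L T_R u) =
        μ N T_L T_R) ∧
      (∀ ϑ : ℝ, 0 < ϑ → ϑ < 1 / max T_L T_R →
        Integrable (fun x => Real.exp (ϑ * (pinnedChain ω₂ lam β γ).hamiltonian N x)) (μ N T_L T_R)) ∧
      μ N T_L T_R ≪ (volume : Measure (PhaseSpace N)) := by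
  intro ω₂ lam β γ hω hl hβ hγ huniq μ hμ N hN T_L T_R hL hR
  have hN1 : 1 < N := by omega
  obtain ⟨ν, hνP, hinv, hint⟩ := pinnedChainSemigroup_exists_isInvariant_of_pos hω hl hβ hγ hN1 hL hR
  have hmax : 0 < max T_L T_R := lt_max_of_lt_left hL
  have hϑ0 : 0 < 1 / max T_L T_R / 2 := by positivity
  have hϑ1 : 1 / max T_L T_R / 2 < 1 / max T_L T_R := half_lt_self (by positivity)
  have hνss : (pinnedChain ω₂ lam β γ).IsSteadyState N T_L T_R ν :=
    pinnedChain_isSteadyState_of_isInvariant hω.le hl.le hβ.le γ N _ hinv hϑ0 (hint _ hϑ0 hϑ1)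
  have hμν : μ N T_L T_R = ν := huniq N T_L T_R hL hR _ _ (hμ N T_L T_R hL hR) hνss
  rw [hμν]
  refine ⟨hνP, fun u => hinv u, fun ϑ h0 h1 => hint ϑ h0 h1, ?_⟩
  refine hinv.absolutelyContinuous_of_kernel _ 1 fun z => ?_
  rw [pinnedChainSemigroup_kernel]
  exact pinnedChain_transitionKernel_one_absolutelyContinuous hω hl.le hβ.le hγ.le N T_L T_R hγ hL
    (by omega) z

/-- **At equal temperatures the unique weak steady state is the Gibbs measure** (every `N`, `T > 0`):
`gibbsMeasure N T` is a weak steady state at `(T, T)` (`pinnedChain_isSteadyState_gibbsMeasure`), so (U)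
identifies the family member `μ N T T` with it. -/
theorem ness_eq_gibbsMeasure {ω₂ lam β γ : ℝ} (hω : 0 < ω₂) (hl : 0 < lam) (hβ : 0 < β)
    (huniq : ∀ (N : ℕ) (T_L T_R : ℝ), 0 < T_L → 0 < T_R → ∀ μ ν : Measure (PhaseSpace N),
      (pinnedChain ω₂ lam β γ).IsSteadyState N T_L T_R μ →
      (pinnedChain ω₂ lam β γ).IsSteadyState N T_L T_R ν → μ = ν)
    (μ : (N : ℕ) → ℝ → ℝ → Measure (PhaseSpace N))
    (hμ : ∀ (N : ℕ) (T_L T_R : ℝ), 0 < T_L → 0 < T_R →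
      (pinnedChain ω₂ lam β γ).IsSteadyState N T_L T_R (μ N T_L T_R))
    (N : ℕ) {T : ℝ} (hT : 0 < T) :
    μ N T T = (pinnedChain ω₂ lam β γ).gibbsMeasure N T :=
  huniq N T T hT hT _ _ (hμ N T T hT hT)
    (pinnedChain_isSteadyState_gibbsMeasure hω hl.le hβ.le γ N hT)

/-- **Under (U), the Gibbs measure is invariant under the constructed equal-temperature kernels**
(`N ≥ 2`, `T > 0`): it is the family member at `(T, T)`, which is the kernel-invariant Krylov–Bogoliubov
measure. -/
theorem gibbsMeasure_bind_transitionKernel {ω₂ lam β γ : ℝ} (hω : 0 < ω₂) (hl : 0 < lam) (hβ : 0 < β)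
    (hγ : 0 < γ)
    (huniq : ∀ (N : ℕ) (T_L T_R : ℝ), 0 < T_L → 0 < T_R → ∀ μ ν : Measure (PhaseSpace N),
      (pinnedChain ω₂ lam β γ).IsSteadyState N T_L T_R μ →
      (pinnedChain ω₂ lam β γ).IsSteadyState N T_L T_R ν → μ = ν)
    {N : ℕ} (hN : 2 ≤ N) {T : ℝ} (hT : 0 < T) (u : ℝ≥0) :
    ((pinnedChain ω₂ lam β γ).gibbsMeasure N T).bind ((pinnedChain ω₂ lam β γ).transitionKernel N T T u) =
      (pinnedChain ω₂ lam β γ).gibbsMeasure N T := by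
  -- the constant family `μ N T_L T_R := some weak steady state` is not needed: use the Gibbs family at
  -- `(T, T)` completed by choice elsewhere; simplest: the family of Krylov–Bogoliubov/CEHR states.
  classical
  -- a steady-state family: CEHR states where they exist (all `T_L, T_R > 0`), junk `0` otherwise
  let μ : (M : ℕ) → ℝ → ℝ → Measure (PhaseSpace M) := fun M a b =>
    if h : 0 < a ∧ 0 < b then (pinnedChain_exists_isSteadyState hω hl hβ hγ M h.1 h.2).choose else 0
  have hμ : ∀ (M : ℕ) (a b : ℝ), 0 < a → 0 < b →
      (pinnedChain ω₂ lam β γ).IsSteadyState M a b (μ M a b) := by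
    intro M a b ha hb
    simp only [μ, dif_pos (And.intro ha hb)]
    exact (pinnedChain_exists_isSteadyState hω hl hβ hγ M ha hb).choose_spec
  obtain ⟨-, hinv, -, -⟩ := ness_facts ω₂ lam β γ hω hl hβ hγ huniq μ hμ N hN T T hT hT
  rw [← ness_eq_gibbsMeasure hω hl hβ huniq μ hμ N hT]
  exact hinv u

end Summit.AtomisticToContinuum.FouriersLaw.Theorems.BondHeatUncertainty

end
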